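import Summits.QuantumFields.YangMills.Theorems.BalabanUVNodesPortU8LocUnivDecay
import Summits.QuantumFields.YangMills.Theorems.BalabanUVNodesPortU8GlobalIdent
import Literature.MathematicalPhysics.QuantumFieldTheory.Balaban1983to89.B5DPD126Uniform

/-!
# PORT PT-B (U8), g4 file 8 — NODE v8 LEAF (D1): THE VALUE CLAUSE OF (‴-LocUniv) IN THE TOKEN's OWN LETTERS —
# ★★★ `norm_recordHrLocξ_univ_le`: `‖recordHrLocξ F θ k K Finset.univ a (μ, y) b‖ ≤ C₁(a)·η·e^{−δ₁·tdist(coarsenTo (k+1) b₋, y)}` with EXPLICIT volume-uniform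
# `C₁(a) = MG163(4)·periodConst(κ₁₆₃(4), 3)·‖ρ₈(bV a)‖`, `δ₁ = κ₁₆₃(4)∕4∕4`, from ✓`norm_windowResp_univ_le` (g4 file 7) + the distance dictionary `tdist ≤ d·|·|_{T,∞}`

Cell `ym-nodeO-ideate` ∕ `ym-balaban-port`, porter `ymgap-nodeO-port-PTB-1` (gen 4).  JOIN-side helper for **stmt-QuantumFields-27238** (K0ᴬ), `--supports … --as helper`.
This is clause 1 (of four) of the displayed hypothesis (‴-LocUniv) of ✓`response9D_LocUniv_of_tokens` ∕ ✓`portPieceLocalityU8_LocUniv`, now a THEOREM.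
[B5] = [Balaban1984PropagatorsI], [B6] = [Balaban1984PropagatorsII], [15] = [Balaban1985Variational], [I] = [Balaban1987RG1].

WHAT IS PROVED (kernel, sorry-free).
§1 The torus-distance dictionary: `emod_neg_le` ∕ `val_sub_cast` (ZMod bookkeeping), ★ `tdist_le_mul_torusSupNorm`: the ℓ¹ torus distance `Site.tdist x y` of `Setup` is at most
   `d ·` the ℓ∞ torus distance `torusSupNorm (Mk P j) (rep x − rep y)` of b04∕b05 (so `e^{−κ·|·|_{T,∞}} ≤ e^{−(κ∕d)·tdist}`).
§2 `norm_recordHrLocξ_le`: `‖recordHrLocξ W a l b‖ ≤ |windowRespξ W l b| · ‖ρ₈(bV a)‖` (entrywise sup norms).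
§3 ★★★ `norm_recordHrLocξ_univ_le` — the value clause of (‴-LocUniv) with the explicit constants above (`η = eta (k+1)`), for every `K`, `k` on the standing range, `a`, `(μ, y)`, `b`.

HONEST FRAMING.  One of the four (190)-type clauses of ONE displayed token is discharged (from [B5] (1.63)'s proved kernel decay); clauses 2–4 and Tok-cmpU-cap stay displayed;
nothing of [15] Prop. 9 ∕ [I] Thm 1 at the record is claimed beyond that; K0ᴬ 27238 OPEN; NODE O 0∕1; COUNT 8∕28 · K 1∕4 UNMOVED; finite `𝕋⁴_{L^K}` at fixed ε —
NOT continuum ∕ OS ∕ Clay; **the Yang–Mills mass gap (Clay) is NOT proved by any of this.**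
-/

noncomputable section

open scoped BigOperators

namespace Summit.QuantumFields.YangMills.Theorems.PortU8

open Literature.MathematicalPhysics.QuantumFieldTheory.Balaban1983to89
open Literature.MathematicalPhysics.QuantumFieldTheory.Balaban1983to89.T4Continuum (T4Family)
open Literature.MathematicalPhysics.QuantumFieldTheory.Balaban1983to89.B5Eq117TorusCarriers (Mk)
open Literature.MathematicalPhysics.QuantumFieldTheory.Balaban1983to89.B5Eq118OneStroke (iterBlockOf)
open Literature.MathematicalPhysics.QuantumFieldTheory.Balaban1983to89.B4TorusKernel (periodConst)
open Literature.MathematicalPhysics.QuantumFieldTheory.Balaban1983to89.B4TorusKernel.MultiPeriod (circAbs torusSupNorm)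
open Literature.MathematicalPhysics.QuantumFieldTheory.Balaban1983to89.B6LowerBound2153Torus (rep)
open Literature.MathematicalPhysics.QuantumFieldTheory.Balaban1983to89.B5Hk163Decay (MG163 MG163_nonneg)
open Literature.MathematicalPhysics.QuantumFieldTheory.Balaban1983to89.B5Hk163Strip (kappa163 kappa163_pos)
open Summit.QuantumFields.YangMills.Theorems.K0RecordFormatNames

variable (F : T4Family)

/-! ## §1  The torus-distance dictionary: ℓ¹ (`Site.tdist`) against ℓ∞ (`torusSupNorm ∘ rep`) -/

/-- For `0 < N`: `min (z mod N) ((−z) mod N) ≤ circAbs N z` (`= min (z mod N) (N − z mod N)`). [folklore] -/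
theorem min_emod_neg_emod_le_circAbs {N : ℕ} (hN : 0 < N) (z : ℤ) :
    min (z % (N : ℤ)) ((-z) % (N : ℤ)) ≤ circAbs N z := by
  have hN' : (0 : ℤ) < N := by exact_mod_cast hN
  have hN0 : (N : ℤ) ≠ 0 := hN'.ne'
  unfold circAbs
  refine min_le_min le_rfl ?_
  -- `(−z) mod N ≤ N − z mod N`
  by_cases h0 : z % (N : ℤ) = 0
  · have hdvd : (N : ℤ) ∣ -z := (Int.dvd_of_emod_eq_zero h0).neg_right
    rw [Int.emod_eq_zero_of_dvd hdvd, h0, sub_zero]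
    exact hN'.le
  · have hlt : z % (N : ℤ) < N := Int.emod_lt_of_pos z hN'
    have hge : 0 ≤ z % (N : ℤ) := Int.emod_nonneg z hN0
    have hrepr : -z = ((N : ℤ) - z % (N : ℤ)) + (N : ℤ) * (-(z / (N : ℤ)) - 1) := by
      have := Int.mul_ediv_add_emod z (N : ℤ)
      linear_combination this
    have hmod : (-z) % (N : ℤ) = (N : ℤ) - z % (N : ℤ) := by
      rw [hrepr, Int.add_mul_emod_self_left]
      exact Int.emod_eq_of_lt (by omega) (by omega)
    rw [hmod]

/-- In `ZMod N`: `((a − b).val : ℤ) = (a.val − b.val) mod N`. [folklore] -/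
theorem val_sub_cast_eq_emod {N : ℕ} [NeZero N] (a b : ZMod N) :
    (((a - b).val : ℕ) : ℤ) = (((a.val : ℕ) : ℤ) - ((b.val : ℕ) : ℤ)) % (N : ℤ) := by
  have h : a - b = (((((a.val : ℕ) : ℤ) - ((b.val : ℕ) : ℤ)) : ℤ) : ZMod N) := by
    push_cast
    rw [ZMod.natCast_zmod_val, ZMod.natCast_zmod_val]
  rw [h, ZMod.val_intCast]

/-- ★ **ℓ¹ ≤ d · ℓ∞ ON THE TORUS** (record lattices, `d = 4`): `Site.tdist x y ≤ 4 · |rep x − rep y|_{T,∞}` (`Setup`'s ℓ¹ torus distance against b04's sup-distance of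
representatives). [folklore] -/
theorem tdist_le_mul_torusSupNorm {K j : ℕ} (x y : Site (F.P K) j) :
    (Site.tdist x y : ℝ) ≤ 4 * torusSupNorm (Mk (F.P K) j) (rep (Mk (F.P K) j) x - rep (Mk (F.P K) j) y) := by
  set S : ℝ := torusSupNorm (Mk (F.P K) j) (rep (Mk (F.P K) j) x - rep (Mk (F.P K) j) y) with hS
  have hterm : ∀ μ : Fin (F.P K).d, ((min (x μ - y μ).val (y μ - x μ).val : ℕ) : ℝ) ≤ S := by
    intro μ
    have hN : 0 < (F.P K).sitesPerDir j := Nat.pos_of_ne_zero ((F.P K).sitesPerDir_ne_zero j)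
    have h1 : (((min (x μ - y μ).val (y μ - x μ).val : ℕ)) : ℤ) ≤ circAbs ((F.P K).sitesPerDir j) ((((x μ).val : ℕ) : ℤ) - (((y μ).val : ℕ) : ℤ)) := by
      rw [Nat.cast_min, val_sub_cast_eq_emod, val_sub_cast_eq_emod,
        show (((y μ).val : ℕ) : ℤ) - (((x μ).val : ℕ) : ℤ) = -((((x μ).val : ℕ) : ℤ) - (((y μ).val : ℕ) : ℤ)) by ring]
      exact min_emod_neg_emod_le_circAbs hN _
    have h2 : ((circAbs ((F.P K).sitesPerDir j) ((((x μ).val : ℕ) : ℤ) - (((y μ).val : ℕ) : ℤ)) : ℤ) : ℝ) ≤ S := by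
      rw [hS]
      unfold torusSupNorm
      exact Finset.le_sup' (fun i => ((circAbs (Mk (F.P K) j i) ((rep (Mk (F.P K) j) x - rep (Mk (F.P K) j) y) i) : ℤ) : ℝ)) (Finset.mem_univ μ)
    have h1' : (((min (x μ - y μ).val (y μ - x μ).val : ℕ)) : ℝ) ≤ ((circAbs ((F.P K).sitesPerDir j) ((((x μ).val : ℕ) : ℤ) - (((y μ).val : ℕ) : ℤ)) : ℤ) : ℝ) := by
      exact_mod_cast h1
    exact h1'.trans h2
  calc (Site.tdist x y : ℝ) = ∑ μ : Fin (F.P K).d, ((min (x μ - y μ).val (y μ - x μ).val : ℕ) : ℝ) := by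
        unfold Site.tdist; push_cast; rfl
    _ ≤ ∑ _μ : Fin (F.P K).d, S := Finset.sum_le_sum fun μ _ => hterm μ
    _ = 4 * S := by rw [Finset.sum_const, Finset.card_univ, Fintype.card_fin, nsmul_eq_mul]; rfl

/-! ## §2  The colour wrapper: `‖HrLocξ W a l b‖ = |windowRespξ W l b| · ‖ρ₈(bV a)‖` -/

/-- `‖recordHrLocξ W a l b‖ = |ξ·windowResp W l b| · ‖ρ₈(bV a)‖` (entrywise sup norms: the response in a colour is the scalar response times a fixed matrix).
[cite: Balaban1987RG1, (3.37) p.277, (4.35) p.290 (bookkeeping)] -/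
theorem norm_recordHrLocξ_eq (a₀ ε₂₉ : ℝ) (k K : ℕ) (W : Finset (Site (F.P K) (k + 1))) (a : (thetaFill F a₀ ε₂₉).ιβ) (l : RespLabel F k K) (b : PBond (F.P K) 0) :
    letI θ := thetaFill F a₀ ε₂₉; letI := θ.instVβ₁; letI := θ.instVβ₂; letI := θ.instιβ
    ‖recordHrLocξ F θ k K W a l b‖ = |windowRespξ F k K W l b| * ‖fun i i' : Fin 2 => θ.ρ8 (θ.bV a) i i'‖ := by
  letI θ := thetaFill F a₀ ε₂₉; letI := θ.instVβ₁; letI := θ.instVβ₂; letI := θ.instιβ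
  have h : recordHrLocξ F θ k K W a l b = ((windowRespξ F k K W l b : ℝ) : ℂ) • (fun i i' : Fin 2 => θ.ρ8 (θ.bV a) i i') := by
    funext i i'
    simp only [recordHrLocξ, Pi.smul_apply, smul_eq_mul]
  rw [h, norm_smul, Complex.norm_real, Real.norm_eq_abs]

/-! ## §3  ★★★ The value clause of (‴-LocUniv), with explicit volume-uniform constants -/

/-- ★★★ **THE VALUE CLAUSE OF (‴-LocUniv), PROVED**: for every volume `K`, level `k`, colour `a`, label `(μ, y)` and fine bond `b`,
`‖recordHrLocξ F θ k K univ a (μ, y) b‖ ≤ C₁(a)·η·e^{−δ₁·tdist(coarsenTo (k+1) b₋, y)}` with `η = eta (k+1)`, `C₁(a) = MG163(d)·periodConst(κ₁₆₃(d), d−1)·‖ρ₈(bV a)‖`,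
`δ₁ = (κ₁₆₃(d)∕d)∕4` (`d = 4`; off the standing range the response is `0`).  From ✓`norm_windowResp_univ_le` ([B5] (1.63) kernel decay) and §1's ℓ¹∕ℓ∞ dictionary.
[cite: Balaban1984PropagatorsI, (1.63) p.28, (1.65)–(1.67) p.29; Balaban1984PropagatorsII, (2.35) p.228; Balaban1985Variational, (190) p.308 (first line); Balaban1987RG1, (4.35) p.290] -/
theorem norm_recordHrLocξ_univ_le (a₀ ε₂₉ : ℝ) (k K : ℕ) (a : (thetaFill F a₀ ε₂₉).ιβ) (μ : Fin (F.P K).d) (y : Site (F.P K) (k + 1)) (b : PBond (F.P K) 0) :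
    letI θ := thetaFill F a₀ ε₂₉; letI := θ.instVβ₁; letI := θ.instVβ₂; letI := θ.instιβ
    ‖recordHrLocξ F θ k K Finset.univ a (μ, y) b‖ ≤
      (MG163 (F.P K).d * periodConst (kappa163 (F.P K).d) ((F.P K).d - 1) * ‖fun i i' : Fin 2 => θ.ρ8 (θ.bV a) i i'‖) * (F.P K).eta (k + 1) *
        Real.exp (-((kappa163 (F.P K).d / ((((F.P K).d - 1 : ℕ) : ℝ) + 1) / 4) * (Site.tdist (coarsenTo (k + 1) b.src) y : ℝ))) := by
  letI θ := thetaFill F a₀ ε₂₉; letI := θ.instVβ₁; letI := θ.instVβ₂; letI := θ.instιβ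
  set R : ℝ := ‖fun i i' : Fin 2 => θ.ρ8 (θ.bV a) i i'‖ with hR
  set A : ℝ := MG163 (F.P K).d * periodConst (kappa163 (F.P K).d) ((F.P K).d - 1) with hA
  set κ : ℝ := kappa163 (F.P K).d / ((((F.P K).d - 1 : ℕ) : ℝ) + 1) with hκ
  have hR0 : 0 ≤ R := norm_nonneg _
  have hA0 : 0 ≤ A := by rw [hA]; exact mul_nonneg (MG163_nonneg _) (B5DPD126Uniform.periodConst_nonneg_of_pos (kappa163_pos _) _)
  have hκ0 : 0 ≤ κ := by rw [hκ]; exact div_nonneg (kappa163_pos _).le (by positivity)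
  have hη0 : 0 ≤ (F.P K).eta (k + 1) := by unfold Params.eta; exact (pow_pos (inv_pos.2 (F.P K).cast_L_pos) _).le
  rw [norm_recordHrLocξ_eq]
  by_cases hk : k + 1 ≤ (F.P K).m + (F.P K).K
  · have hw := norm_windowResp_univ_le F hk (μ, y) b
    have hdist := tdist_le_mul_torusSupNorm F (coarsenTo (k + 1) b.src) y
    have hexp : Real.exp (-(κ * torusSupNorm (Mk (F.P K) (k + 1)) (rep (Mk (F.P K) (k + 1)) (iterBlockOf (k + 1) b.src) - rep (Mk (F.P K) (k + 1)) y))) ≤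
        Real.exp (-(κ / 4 * (Site.tdist (coarsenTo (k + 1) b.src) y : ℝ))) := by
      refine Real.exp_le_exp.2 (neg_le_neg ?_)
      rw [← coarsenTo_eq_iterBlockOf]
      have := mul_le_mul_of_nonneg_left hdist hκ0
      linarith
    have hξ : |windowRespξ F k K Finset.univ (μ, y) b| = (F.P K).eta (k + 1) * |windowResp F k K Finset.univ (μ, y) b| := by
      rw [windowRespξ, abs_mul, abs_of_nonneg hη0]
    rw [hξ]
    calc (F.P K).eta (k + 1) * |windowResp F k K Finset.univ (μ, y) b| * R
        ≤ (F.P K).eta (k + 1) * (A * Real.exp (-(κ / 4 * (Site.tdist (coarsenTo (k + 1) b.src) y : ℝ)))) * R := by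
          refine mul_le_mul_of_nonneg_right (mul_le_mul_of_nonneg_left (hw.trans ?_) hη0) hR0
          exact mul_le_mul_of_nonneg_left hexp hA0
      _ = A * R * (F.P K).eta (k + 1) * Real.exp (-(κ / 4 * (Site.tdist (coarsenTo (k + 1) b.src) y : ℝ))) := by ring
  · rw [windowRespξ_of_not_le F hk, abs_zero, zero_mul]
    positivity


end Summit.QuantumFields.YangMills.Theorems.PortU8

end
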